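import Summits.KontsevichZagierPeriods.KontsevichZagierPeriods.Theorems.IsogenyCertificatesXMapKernelStubHuberWustholzSplitting
import Literature.NumberTheory.EllipticCurves.RealPeriodProofs
import Mathlib.GroupTheory.Archimedean

/-!
# `XMapKernel`, line `isogeny-orbit-collapse` — stub **R-b2**, auxiliary file

Multipliers out of a lattice without complex multiplication.

Support file for the crux `IsogenyCertificates.XMapKernel` (stmt-KontsevichZagierPeriods-10663),
line `isogeny-orbit-collapse`, stub `stub_nonCMClass` (R-b2, the non-CM class); this auxiliary
file carries the lattice-theoretic half of R-b2 and its registered main theorem is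
`stub_nonCMClass_certificate`. Setting: `Λ₀` a lattice WITHOUT complex multiplication
(`¬ PeriodPair.HasCM`), `Λ'` another lattice, `Hom(Λ₀, Λ') = {γ | γΛ₀ ⊆ Λ'}` its multipliers,
and the `Aut(ℂ)`-rigidity of multipliers `Λ₀ → Λ'` (stub R-b0, which holds when both lattices
have rational invariants) taken as a HYPOTHESIS.

1. *Non-CM rank one* (`exists_nat_of_mul_mem`, `exists_generator`). If `γ ≠ 0` and `δ` are
   multipliers then `NΛ' ⊆ γΛ₀` for some `N ≥ 1` (`exists_nat_mul_mem_of_le`: a sub-lattice has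
   finite index), so `(Nδ/γ)Λ₀ ⊆ Λ₀` and `Nδ/γ ∈ ℤ` because `Λ₀` has no CM. Hence the integers
   `m` with `(m/N)α` a multiplier form a subgroup of `ℤ`, cyclic (`Int.subgroup_cyclic`):
   `Hom(Λ₀, Λ') = ℤγ₀` with `α ∈ ℚγ₀`.
2. *Rigidity* (`ringEquiv_apply_generator`, `sq_ratCast_and_conj`). Every `σ ∈ Aut(ℂ)` maps
   `Hom(Λ₀, Λ')` into itself, and so does `σ⁻¹`; on `ℤγ₀` this forces `σ(γ₀) = ±γ₀`, so `γ₀²`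
   is fixed by `Aut(ℂ)`, i.e. rational (`exists_ratCast_eq_of_forall_ringEquiv`, Cox §10.C), and
   `α = cγ₀` (`c ∈ ℚ`) has `α² ∈ ℚ`; with `σ = conj` (`starRingAut`): `conj α = ±α`, i.e.
   `α = t` or `α = ti` with `t` real and `t² ∈ ℚ`.
3. *Real structure* (`stub_nonCMClass_certificate`). For real lattices `Λ₀`, `Λ'`:
   `Λ₀ ∩ ℝ = ℤu`, `Λ₀ ∩ iℝ = ℤ·iv` with `u = Ω₀(Λ₀)`, `v = Ω₀(iΛ₀)` the least positive real
   periods of `Λ₀` and of the rotated real lattice `iΛ₀` (`IsReal.exists_eq_int_mul`,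
   `IsReal.mulLeft_I`). From `N·Ω₀(Λ')/α ∈ Λ₀` one gets `Ω₀(Λ') = (m/N)·t·u` if `α = t` is real
   and `Ω₀(Λ') = (m/N)·t·v` if `α = ti` is purely imaginary (`m ∈ ℤ`).

No definitions, no named facts. The companion file `…StubNonCMClass.lean` adds Masser's theorem
and the radical bookkeeping and proves R-b2.

References: D. A. Cox, *Primes of the form x² + ny²* (2013), §10.C; J. H. Silverman, *The
Arithmetic of Elliptic Curves* (2009), Thm. VI.5.1, Cor. VI.5.1.1; D. F. Lawden, *Elliptic
Functions and Applications* (1989), §6.15.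
-/

noncomputable section

namespace Summit.KontsevichZagierPeriods.IsogenyCertificates.XMapKernelStubs.NonCMClass

open scoped ComplexConjugate
open Complex Literature.NumberTheory.EllipticCurves

/-! ## §1 Multipliers out of a non-CM lattice -/

/-- A multiplier of a lattice without complex multiplication is an integer (definition of
`PeriodPair.HasCM`, contraposed). [folklore] -/
theorem exists_intCast_of_mul_mem {L₀ : PeriodPair} (hCM : ¬ L₀.HasCM) {β : ℂ}
    (hβ : ∀ l ∈ L₀.lattice, β * l ∈ L₀.lattice) : ∃ n : ℤ, β = n := by
  by_contra h
  exact hCM ⟨β, fun n hn => h ⟨n, hn⟩, hβ⟩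

/-- **Non-CM rank one.** If `γ ≠ 0` is a multiplier `γΛ₀ ⊆ Λ'` out of a lattice `Λ₀` without
complex multiplication, then for some integer `N ≥ 1` one has `NΛ' ⊆ γΛ₀`, and every multiplier
`δΛ₀ ⊆ Λ'` satisfies `Nδ = mγ` with `m ∈ ℤ` (`Nδ/γ` is a multiplier of `Λ₀`). [folklore] -/
theorem exists_nat_of_mul_mem {L₀ L' : PeriodPair} (hCM : ¬ L₀.HasCM) {γ : ℂ} (hγ : γ ≠ 0)
    (hγL : ∀ l ∈ L₀.lattice, γ * l ∈ L'.lattice) :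
    ∃ N : ℕ, N ≠ 0 ∧ (∀ y ∈ L'.lattice, (N : ℂ) * (γ⁻¹ * y) ∈ L₀.lattice) ∧
      ∀ δ : ℂ, (∀ l ∈ L₀.lattice, δ * l ∈ L'.lattice) → ∃ m : ℤ, (N : ℂ) * δ = m * γ := by
  have hγi : γ⁻¹ ≠ 0 := inv_ne_zero hγ
  have hle : L₀.lattice ≤ (L'.mulLeft γ⁻¹ hγi).lattice := fun l hl =>
    PeriodPair.mem_mulLeft_lattice.2 (by rw [inv_inv]; exact hγL l hl)
  obtain ⟨N, hN, hNM⟩ := HuberWustholzSplitting.exists_nat_mul_mem_of_le hle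
  have hN' : ∀ y ∈ L'.lattice, (N : ℂ) * (γ⁻¹ * y) ∈ L₀.lattice := fun y hy =>
    hNM _ (PeriodPair.mem_mulLeft_lattice.2
      (by rwa [inv_inv, ← mul_assoc, mul_inv_cancel₀ hγ, one_mul]))
  refine ⟨N, hN, hN', fun δ hδ => ?_⟩
  obtain ⟨m, hm⟩ := exists_intCast_of_mul_mem hCM (β := (N : ℂ) * (γ⁻¹ * δ)) fun l hl => by
    have e : (N : ℂ) * (γ⁻¹ * δ) * l = (N : ℂ) * (γ⁻¹ * (δ * l)) := by ring
    rw [e]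
    exact hN' _ (hδ l hl)
  refine ⟨m, ?_⟩
  calc (N : ℂ) * δ = (N : ℂ) * (γ⁻¹ * δ) * γ := by field_simp
    _ = m * γ := by rw [hm]

/-- **A generator of `Hom(Λ₀, Λ')`.** For `Λ₀` without complex multiplication and a multiplier
`α ≠ 0`, `αΛ₀ ⊆ Λ'`, there is a multiplier `γ₀` with `α ∈ ℚγ₀` such that every multiplier
`δΛ₀ ⊆ Λ'` is an integer multiple of `γ₀`: the integers `m` with `(m/N)α` a multiplier form a
subgroup of `ℤ`, which is cyclic (`Int.subgroup_cyclic`). [folklore] -/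
theorem exists_generator {L₀ L' : PeriodPair} (hCM : ¬ L₀.HasCM) {α : ℂ} (hα : α ≠ 0)
    (hαL : ∀ l ∈ L₀.lattice, α * l ∈ L'.lattice) :
    ∃ γ₀ : ℂ, (∀ l ∈ L₀.lattice, γ₀ * l ∈ L'.lattice) ∧ (∃ c : ℚ, α = c * γ₀) ∧
      ∀ δ : ℂ, (∀ l ∈ L₀.lattice, δ * l ∈ L'.lattice) → ∃ n : ℤ, δ = n * γ₀ := by
  obtain ⟨N, hN, -, hhom⟩ := exists_nat_of_mul_mem hCM hα hαL
  have hNc : (N : ℂ) ≠ 0 := by exact_mod_cast hN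
  -- the integers `m` such that `(m/N) α` is a multiplier form a subgroup of `ℤ`
  let H : AddSubgroup ℤ :=
    { carrier := {m : ℤ | ∀ l ∈ L₀.lattice, (m : ℂ) / N * α * l ∈ L'.lattice}
      add_mem' := fun {a b} ha hb l hl => by
        have ha' : ∀ l ∈ L₀.lattice, (a : ℂ) / N * α * l ∈ L'.lattice := ha
        have hb' : ∀ l ∈ L₀.lattice, (b : ℂ) / N * α * l ∈ L'.lattice := hb
        have e : ((a + b : ℤ) : ℂ) / N * α * l = (a : ℂ) / N * α * l + (b : ℂ) / N * α * l := by
          push_cast; ring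
        rw [e]
        exact add_mem (ha' l hl) (hb' l hl)
      zero_mem' := fun l _ => by simp
      neg_mem' := fun {a} ha l hl => by
        have ha' : ∀ l ∈ L₀.lattice, (a : ℂ) / N * α * l ∈ L'.lattice := ha
        have e : ((-a : ℤ) : ℂ) / N * α * l = -((a : ℂ) / N * α * l) := by push_cast; ring
        rw [e]
        exact neg_mem (ha' l hl) }
  have hmemH : ∀ m : ℤ, m ∈ H ↔ ∀ l ∈ L₀.lattice, (m : ℂ) / N * α * l ∈ L'.lattice :=
    fun m => Iff.rfl
  obtain ⟨d, hd⟩ := Int.subgroup_cyclic H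
  refine ⟨(d : ℂ) / N * α, ?_, ?_, ?_⟩
  · have hdH : d ∈ H := by rw [hd]; exact AddSubgroup.subset_closure rfl
    exact (hmemH d).1 hdH
  · have hNH : (N : ℤ) ∈ H := (hmemH N).2 fun l hl => by
      have e : ((N : ℤ) : ℂ) / N * α * l = α * l := by push_cast; rw [div_self hNc, one_mul]
      rw [e]
      exact hαL l hl
    rw [hd, AddSubgroup.mem_closure_singleton] at hNH
    obtain ⟨n, hn⟩ := hNH
    have hd0 : (d : ℂ) ≠ 0 := by
      intro h0
      have hdz : d = 0 := by exact_mod_cast h0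
      rw [hdz, smul_zero] at hn
      exact hN (by exact_mod_cast hn.symm)
    refine ⟨(N : ℚ) / d, ?_⟩
    push_cast
    field_simp
  · intro δ hδ
    obtain ⟨m, hm⟩ := hhom δ hδ
    have hδ' : δ = (m : ℂ) / N * α := by rw [div_mul_eq_mul_div, ← hm]; field_simp
    have hmH : m ∈ H := (hmemH m).2 fun l hl => by rw [← hδ']; exact hδ l hl
    rw [hd, AddSubgroup.mem_closure_singleton] at hmH
    obtain ⟨n, hn⟩ := hmH
    refine ⟨n, ?_⟩
    rw [hδ', ← hn, zsmul_eq_mul]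
    push_cast
    ring

/-! ## §2 Rigidity: `σ(γ₀) = ±γ₀`, `α² ∈ ℚ`, `conj α = ±α` -/

/-- **`Aut(ℂ)` acts on a generator by a sign.** If every field automorphism of `ℂ` carries
non-zero multipliers `Λ₀ → Λ'` to multipliers (R-b0 for lattices with rational invariants) and
`γ₀ ≠ 0` generates all multipliers over `ℤ`, then `σ(γ₀) = ±γ₀`: `σ(γ₀) = nγ₀` and
`σ⁻¹(γ₀) = n'γ₀` with `nn' = 1`. [folklore] -/
theorem ringEquiv_apply_generator {L₀ L' : PeriodPair}
    (hRig : ∀ (γ : ℂ) (σ : ℂ ≃+* ℂ), γ ≠ 0 → (∀ l ∈ L₀.lattice, γ * l ∈ L'.lattice) →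
      ∀ l ∈ L₀.lattice, σ γ * l ∈ L'.lattice)
    {γ₀ : ℂ} (hγ₀ : γ₀ ≠ 0) (hγ₀L : ∀ l ∈ L₀.lattice, γ₀ * l ∈ L'.lattice)
    (hgen : ∀ δ : ℂ, (∀ l ∈ L₀.lattice, δ * l ∈ L'.lattice) → ∃ n : ℤ, δ = n * γ₀)
    (σ : ℂ ≃+* ℂ) : σ γ₀ = γ₀ ∨ σ γ₀ = -γ₀ := by
  obtain ⟨n, hn⟩ := hgen _ (hRig γ₀ σ hγ₀ hγ₀L)
  obtain ⟨n', hn'⟩ := hgen _ (hRig γ₀ σ.symm hγ₀ hγ₀L)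
  have h1 : γ₀ = (n' : ℂ) * (n * γ₀) :=
    calc γ₀ = σ (σ.symm γ₀) := (σ.apply_symm_apply γ₀).symm
      _ = (n' : ℂ) * (n * γ₀) := by rw [hn', map_mul, map_intCast, hn]
  have h2 : ((n' : ℂ) * n - 1) * γ₀ = 0 := by linear_combination -h1
  have h3 : (n' : ℂ) * n = 1 := by
    have := (mul_eq_zero.1 h2).resolve_right hγ₀
    linear_combination this
  have h4 : n' * n = 1 := by exact_mod_cast h3
  rcases Int.eq_one_or_neg_one_of_mul_eq_one' h4 with ⟨-, rfl⟩ | ⟨-, rfl⟩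
  · left; rw [hn]; simp
  · right; rw [hn]; simp

/-- **`α² ∈ ℚ` and `conj α = ±α`** for a non-zero multiplier `αΛ₀ ⊆ Λ'` out of a non-CM lattice,
when `Aut(ℂ)` preserves multipliers `Λ₀ → Λ'` (R-b0): with `Hom(Λ₀, Λ') = ℤγ₀`
(`exists_generator`) and `σ(γ₀) = ±γ₀` (`ringEquiv_apply_generator`), `γ₀²` is fixed by
`Aut(ℂ)` hence rational (`exists_ratCast_eq_of_forall_ringEquiv`, Cox §10.C), `α = cγ₀` with
`c ∈ ℚ`, and complex conjugation is one such `σ`. [folklore] -/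
theorem sq_ratCast_and_conj {L₀ L' : PeriodPair}
    (hRig : ∀ (γ : ℂ) (σ : ℂ ≃+* ℂ), γ ≠ 0 → (∀ l ∈ L₀.lattice, γ * l ∈ L'.lattice) →
      ∀ l ∈ L₀.lattice, σ γ * l ∈ L'.lattice)
    (hCM : ¬ L₀.HasCM) {α : ℂ} (hα : α ≠ 0) (hαL : ∀ l ∈ L₀.lattice, α * l ∈ L'.lattice) :
    (∃ e : ℚ, (e : ℂ) = α ^ 2) ∧ (conj α = α ∨ conj α = -α) := by
  obtain ⟨γ₀, hγ₀L, ⟨c, hc⟩, hgen⟩ := exists_generator hCM hα hαL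
  have hγ₀ : γ₀ ≠ 0 := by
    rintro rfl
    exact hα (by rw [hc, mul_zero])
  have hpm := fun σ => ringEquiv_apply_generator hRig hγ₀ hγ₀L hgen σ
  refine ⟨?_, ?_⟩
  · have hfix : ∀ σ : ℂ ≃+* ℂ, σ (γ₀ ^ 2) = γ₀ ^ 2 := fun σ => by
      rw [map_pow]
      rcases hpm σ with h | h
      · rw [h]
      · rw [h]; ring
    obtain ⟨e, he⟩ := exists_ratCast_eq_of_forall_ringEquiv hfix
    exact ⟨c ^ 2 * e, by rw [hc]; push_cast; rw [he]; ring⟩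
  · have hcq : conj (c : ℂ) = c := map_ratCast _ c
    rcases hpm (starRingAut : ℂ ≃+* ℂ) with h | h
    · left
      rw [starRingAut_apply] at h
      rw [hc, map_mul, hcq, starRingEnd_apply, h]
    · right
      rw [starRingAut_apply] at h
      rw [hc, map_mul, hcq, starRingEnd_apply, h, mul_neg]

/-! ## §3 The certificate of one multiplier: `Ω₀(Λ') ∈ ℚ·t·u` or `ℚ·t·v` -/

/-- **Certificate of a multiplier.** Let `Λ₀` (no CM) and `Λ'` be real lattices such that
`Aut(ℂ)` preserves multipliers `Λ₀ → Λ'` (R-b0), and `α ≠ 0` with `αΛ₀ ⊆ Λ'`. Then there are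
`N ≥ 1` with `NΛ' ⊆ αΛ₀`, a real `t ≠ 0` with `t² ∈ ℚ`, and `m ∈ ℤ` such that EITHER `α = t` is
real and `Ω₀(Λ') = (m/N)·t·Ω₀(Λ₀)` (`NΩ₀(Λ')/t ∈ Λ₀ ∩ ℝ = ℤΩ₀(Λ₀)`), OR `α = ti` is purely
imaginary and `Ω₀(Λ') = (m/N)·t·Ω₀(iΛ₀)` (`NΩ₀(Λ')/t ∈ Λ₀ ∩ iℝ`, read in the real rotated
lattice `iΛ₀`); by `sq_ratCast_and_conj` and `IsReal.exists_eq_int_mul`. This is the support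
file's registered main theorem (helper of stub R-b2, `stub_nonCMClass`). [folklore] -/
theorem stub_nonCMClass_certificate : ∀ (L₀ L' : PeriodPair), (∀ (γ : ℂ) (σ : ℂ ≃+* ℂ), γ ≠ 0 → (∀ l ∈ L₀.lattice, γ * l ∈ L'.lattice) → ∀ l ∈ L₀.lattice, σ γ * l ∈ L'.lattice) → ¬ L₀.HasCM → L₀.IsReal → L'.IsReal → ∀ (α : ℂ), α ≠ 0 → (∀ l ∈ L₀.lattice, α * l ∈ L'.lattice) → ∃ (N : ℕ) (t : ℝ) (e : ℚ) (m : ℤ), N ≠ 0 ∧ t ≠ 0 ∧ t ^ 2 = (e : ℝ) ∧ (∀ y ∈ L'.lattice, (N : ℂ) * (α⁻¹ * y) ∈ L₀.lattice) ∧ ((α.im = 0 ∧ α = t ∧ L'.minRealPeriod = m / N * t * L₀.minRealPeriod) ∨ (α.im ≠ 0 ∧ α = t * Complex.I ∧ L'.minRealPeriod = m / N * t * (L₀.mulLeft Complex.I Complex.I_ne_zero).minRealPeriod)) := by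
  intro L₀ L' hRig hCM hreal₀ hreal' α hα hαL
  obtain ⟨N, hN, hNL, -⟩ := exists_nat_of_mul_mem hCM hα hαL
  obtain ⟨⟨e, he⟩, hconj⟩ := sq_ratCast_and_conj hRig hCM hα hαL
  have hNr : (N : ℝ) ≠ 0 := by exact_mod_cast hN
  have hw : 0 < L'.minRealPeriod := hreal'.minRealPeriod_pos
  have hwmem : (N : ℂ) * (α⁻¹ * L'.minRealPeriod) ∈ L₀.lattice :=
    hNL _ hreal'.minRealPeriod_mem_lattice
  rcases hconj with hc | hc
  · -- a real multiplier
    obtain ⟨t, rfl⟩ : ∃ t : ℝ, α = t := ⟨α.re, (conj_eq_iff_re.1 hc).symm⟩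
    have ht : t ≠ 0 := fun h0 => hα (by rw [h0, ofReal_zero])
    have hte : t ^ 2 = (e : ℝ) := by exact_mod_cast he.symm
    have hmem : (((N : ℝ) * L'.minRealPeriod / t : ℝ) : ℂ) ∈ L₀.lattice := by
      convert hwmem using 1
      push_cast
      field_simp
    obtain ⟨m, hm⟩ := hreal₀.exists_eq_int_mul hmem
    refine ⟨N, t, e, m, hN, ht, hte, hNL, Or.inl ⟨ofReal_im t, rfl, ?_⟩⟩
    rw [div_eq_iff ht] at hm
    field_simp
    linear_combination hm
  · -- a purely imaginary multiplier
    have hre : α.re = 0 := by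
      have := congrArg Complex.re hc
      simp only [conj_re, neg_re] at this
      linarith
    obtain ⟨t, rfl⟩ : ∃ t : ℝ, α = t * I := ⟨α.im, Complex.ext (by simp [hre]) (by simp)⟩
    have ht : t ≠ 0 := fun h0 => hα (by rw [h0, ofReal_zero, zero_mul])
    have hte : t ^ 2 = ((-e : ℚ) : ℝ) := by
      have h1 : ((t : ℂ) * I) ^ 2 = -(t : ℂ) ^ 2 := by rw [mul_pow, I_sq]; ring
      rw [h1] at he
      have h2 : ((t ^ 2 : ℝ) : ℂ) = ((-e : ℚ) : ℝ) := by push_cast; linear_combination he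
      exact_mod_cast h2
    have hmem : (((N : ℝ) * L'.minRealPeriod / t : ℝ) : ℂ) ∈ (L₀.mulLeft I I_ne_zero).lattice := by
      rw [PeriodPair.mem_mulLeft_lattice, inv_I]
      convert hwmem using 1
      have hI : ((t : ℂ) * I)⁻¹ = -I * (t : ℂ)⁻¹ := by
        rw [mul_inv, inv_I]; ring
      rw [hI]
      push_cast
      field_simp
    obtain ⟨m, hm⟩ := hreal₀.mulLeft_I.exists_eq_int_mul hmem
    refine ⟨N, t, -e, m, hN, ht, hte, hNL, Or.inr ⟨?_, rfl, ?_⟩⟩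
    · simpa using ht
    · rw [div_eq_iff ht] at hm
      field_simp
      linear_combination hm

end Summit.KontsevichZagierPeriods.IsogenyCertificates.XMapKernelStubs.NonCMClass
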